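import Summits.QuantumFields.BalabanUV.T4Continuum.Support.ClusterRepDecay

/-!
# NE5 ∕ U3, route P2 — NON-VACUITY WITNESS for the domain-geometry representation and its lettered leaves L03 ∕ L08
# (`ClusterRepOfDomains`, `ClusterRepKP`, `ClusterRepDecay`): a one-cube geometry on which `DomainGeometry`, the (1.26) ∕ (2.27) ∕
# (2.30) shapes, the locality data and the two inequalities hold with explicit numbers, so `KPInflated`, `DecayExtract` and
# `PinBudget` are OBTAINED from the generic theorems (skeleton `t4/skeletons/NE5-t4-ne5-p2.md` §5 O1′, §6)

Cell `pub-balaban`, unit `b2b-balaban-t4-ne5-p2-g17` (T⁴ fan-out NE5 ∕ node U3, PROVER seat P2).  Summits-side bookkeeping (a toy; NOT a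
model of [Balaban1988RG2Cluster]'s lattice).  HONEST FRAMING: rung (B)+1 of the FINITE-VOLUME T⁴ continuum programme — NOT infinite
volume, NOT a mass gap, NOT the Clay problem, NOT a proof of NE5; spine 0∕9.  HONEST DEPENDENCY (cell line, verbatim): continuum YM on
T⁴ ⇐ BetaPertH ∧ nine spine estimates (0/9 proved); BetaPertH ⇐ (D1) ∧ (D4) ∧ CAP+tail; G-an2-4 gates asym, D1 and NE2/3/4.

WHAT THIS FILE DOES.  The generic suppliers `DomainGeometry.clusterRep` (p207086), `kpInflated_of_majorant` (p207377),
`decayExtract_of_ineq227` ∕ `pinBudget_of_volBound` (p207439) carry hypothesis lists (geometry fields, (1.26)∕(2.27)∕(2.30) SHAPES at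
every level, footprint locality, rate room, smallness).  This file exhibits ONE instance meeting all of them simultaneously — the
one-cube torus: `Dom = ℕ` (one domain per creation step, `scale = id`, tree length `0`), `Cube = Unit`, every footprint `{()}`,
`level k = {k}`, touching = `True`, `reach _ = {()}` (ν = 1); (1.26) with `K₀ = 1`, (2.30) with `c₁ = 1`, (2.27) with any `c`; the
majorant `m ≡ A`; and the numbers `A = 1∕100`, `R = 3`, `κ₀ = 0`, `σ = 2`, `τ = 1`, `c = 0`, `s = 1`, `κ = 1` satisfy the rate room
`κ₀ + σ + τc₁ ≤ R`, the smallness `(1 + s)·A·e^{σc+τc₁}·K₀·ν ≤ τ` (`2·e∕100 ≤ 1`) and `κ + 1 ≤ σ` — whence `toy_kpInflated`, `toy_decayExtract`,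
`toy_pinBudget` BY THE GENERIC THEOREMS (no hypothesis of theirs is contradictory).  Nothing printed is asserted.  0 sorry.
-/

namespace Summit.QuantumFields.BalabanUV.T4Continuum.ClusterRepOfDomainsWitness

open Literature.MathematicalPhysics.QuantumFieldTheory.Balaban1983to89.T4OutputRate (Carriers)
open Literature.MathematicalPhysics.QuantumFieldTheory.Balaban1983to89.T4ActivityRecursion (KPInflated)
open Literature.MathematicalPhysics.QuantumFieldTheory.Balaban1983to89.B13FamilySum (Ineq126 VolBound Ineq227 coveringFamilies)
open Summit.QuantumFields.BalabanUV.T4Continuum.ClusterRepOfDomains (DomainGeometry)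
open Summit.QuantumFields.BalabanUV.T4Continuum.ClusterRepKP (kpInflated_of_majorant)
open Summit.QuantumFields.BalabanUV.T4Continuum.ClusterRepDecay (decayExtract_of_ineq227 pinBudget_of_volBound)

/-- [folklore] The one-cube toy carriers: one domain per creation step, tree length `0`, trivial backgrounds (`abbrev`, so that
`Dom = ℕ` unfolds for instance search). -/
abbrev toyC : Carriers where
  Dom := ℕ
  scale := fun k => k
  d := fun _ => 0
  d_nonneg := fun _ => le_rfl
  BgA := Unit
  BgB := Unit
  gauge := fun _ _ => 0
  gauge_nonneg := fun _ _ => le_rfl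
  transport := fun u => u

/-- [folklore] The one-cube domain geometry: every footprint is the one cube, 𝐃_k = {k}, everything touches. -/
def toyG : DomainGeometry toyC Unit where
  cubes := fun _ => {()}
  level := fun k => {k}
  mem_level := fun Y k => by simp
  touch := fun _ _ => True
  touch_symm := fun _ _ h => h
  touch_of_inter := fun _ _ _ => trivial
  cubes_nonempty := fun _ => Finset.singleton_nonempty _

/-- [folklore] (1.26) on every level with `κ₀ = 0`, `K₀ = 1`. -/
theorem toy_ineq126 (k : ℕ) : Ineq126 (toyG.level k) toyG.cubes toyC.d 0 1 := by
  intro c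
  have hfilter : (toyG.level k).filter (fun Y => c ∈ toyG.cubes Y) = {k} := by
    ext Y; simp [toyG]
  rw [hfilter, Finset.sum_singleton]
  simp

/-- [folklore] (2.30) on every level with `c₁ = 1`. -/
theorem toy_volBound (k : ℕ) : VolBound (toyG.level k) toyG.cubes toyC.d 1 := by
  intro Y _
  simp [toyG, toyC]

/-- [folklore] (2.27) on every level, any `c`: the only covering family of the one cube inside `{k}` is `{k}`. -/
theorem toy_ineq227 (c : ℝ) (X : ℕ) : Ineq227 (toyG.level (toyC.scale X)) toyG.cubes toyC.d (toyG.cubes X) (toyC.d X) c := by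
  intro D hD
  have hD' : D ⊆ {X} ∧ D.biUnion toyG.cubes = {()} := by
    simpa [coveringFamilies, toyG, toyC] using hD
  have hDX : D = {X} := by
    rcases Finset.subset_singleton_iff.1 hD'.1 with h | h
    · exfalso
      have := hD'.2
      rw [h, Finset.biUnion_empty] at this
      exact Finset.singleton_ne_empty () this.symm
    · exact h
  subst hDX
  simp [toyC]

/-- [folklore] Footprint locality with `reach _ = {()}`. -/
theorem toy_loc (Z Z' : ℕ) (_h : toyG.touch (toyG.cubes Z') (toyG.cubes Z)) : ∃ q ∈ ({()} : Finset Unit), q ∈ toyG.cubes Z' :=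
  ⟨(), Finset.mem_singleton_self _, Finset.mem_singleton_self _⟩

/-- [folklore] `#reach = 1 = 1·#cubes`. -/
theorem toy_reach (Z : ℕ) : ((({()} : Finset Unit)).card : ℝ) ≤ 1 * (toyG.cubes Z).card := by
  simp [toyG]

/-- [folklore] **L03 for the toy BY THE GENERIC THEOREM**: `KPInflated` for the constant majorant `m ≡ 1/100` with `s = 1`, `τ = 1`, `σ = 2`,
`b = σ·c = 0` (rate room `0 + 2 + 1·1 ≤ 3`, smallness `2·(1/100)·e^{0+1}·1·1 ≤ 1`). -/
theorem toy_kpInflated (ρA ρB : (ℕ → ℝ) → toyC.BgB → toyC.Dom → ℂ) (W : Set (ℕ → ℝ)) :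
    KPInflated (toyG.clusterRep ρA ρB) W (fun _ _ _ => 1 / 100) 1 (fun Z => 1 * ((toyG.cubes Z).card : ℝ))
      (fun Z => 2 * toyC.d Z + 2 * 0) := by
  have hsmall : (1 + 1) * (1 / 100 : ℝ) * Real.exp (2 * 0 + 1 * 1) * 1 * 1 ≤ 1 := by
    have he : Real.exp 1 ≤ 3 := by
      have := Real.exp_one_lt_d9; norm_num at this ⊢; linarith
    norm_num; nlinarith
  exact kpInflated_of_majorant toyG ρA ρB (fun _ => {()}) toyC.d (A := 1 / 100) (R := 3) (κ₀ := 0) (K₀ := 1) (c₁ := 1)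
    (τ := 1) (σ := 2) (b := 2 * 0) (ν := 1) (s := 1) toy_loc toy_reach (fun _ => le_rfl) (by norm_num) zero_le_one zero_le_one
    (by norm_num) (by norm_num) zero_le_one (fun _ _ _ => by norm_num)
    (fun g _ U k Z _ => by simp) toy_ineq126 toy_volBound (by norm_num) (by simpa using hsmall)

/-- [folklore] **L08 (decay extraction) for the toy BY THE GENERIC THEOREM** (`σ = 2`, `c = 0`). -/
theorem toy_decayExtract (ρA ρB : (ℕ → ℝ) → toyC.BgB → toyC.Dom → ℂ) :
    (toyG.clusterRep ρA ρB).DecayExtract (fun X => 2 * (toyC.d X + 0)) (fun Z => 2 * toyC.d Z + 2 * 0) :=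
  decayExtract_of_ineq227 toyG ρA ρB (by norm_num) (toy_ineq227 0)

/-- [folklore] **L08 (pin budget) for the toy BY THE GENERIC THEOREM** (`τ = c₁ = 1`, `σ = 2`, `κ = 1`, `c = 0`; output amplitude `e^0 = 1`). -/
theorem toy_pinBudget (ρA ρB : (ℕ → ℝ) → toyC.BgB → toyC.Dom → ℂ) :
    (toyG.clusterRep ρA ρB).PinBudget (fun Z => 1 * ((toyG.cubes Z).card : ℝ)) (fun X => 2 * (toyC.d X + 0))
      (1 * 1 * Real.exp (-(2 * 0))) 1 :=
  pinBudget_of_volBound toyG ρA ρB zero_le_one zero_le_one (by norm_num) toy_volBound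

end Summit.QuantumFields.BalabanUV.T4Continuum.ClusterRepOfDomainsWitness
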